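import Summits.BirchSwinnertonDyer.BirchSwinnertonDyer.Theorems.ByReductionTypeAtTwoMultTowerLocalAddvOddOrdInertia
import Summits.BirchSwinnertonDyer.BirchSwinnertonDyer.Theorems.ByReductionTypeAtTwoMultTowerLocalAddvPotGood
import HarnessLib

/-!
# Route `ByReductionTypeAtTwo`, crux `MultUpperHalfAtTwo` (item stmt-BirchSwinnertonDyer-19922): ONE BIT at an odd ADDITIVE prime
# with `ord_v(Δ_min)` ODD — part 2: `𝒦_{v,n}[2^∞]` is CYCLIC (`#𝒦_{v,n}[2] ≤ 2`) and the certificate over `ℚ`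

Part 2 of the lever (L1) of the seat census `mult2/gen9/NOTE-L1-Instar-odd-one-bit.md`. At an additive place `v ∤ 2` of ANY number field
whose minimal discriminant has ODD valuation (Kodaira `I_n*` with `n` odd, `III`, `III*`), Greenberg's local tower kernel `𝒦_{v,n}[2^∞]`
is finite CYCLIC (of order `≤ 4`) at every layer `n` of every `ℤ₂`-extension, hence has at most `2` elements killed by `2`: ONE bit in
the tower-gap certificate instead of the blanket two (`lemma33_natCard_localTowerKerPrimary_le_four_of_additive`: `#𝒦 ≤ 4`).
* §2 `finite_isAddCyclic_localTowerKerPrimary_of_inertiaPrimary_cyclic` — the tree's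
  `finite_and_natCard_localTowerKerPrimary_le_of_inertiaPrimary` (Greenberg pp. 87–88: `𝒦_{v,n} ↪ M'/(g−1)M'` inside the image of
  `B' = E(K̄_v)^I[p^∞]`) VERBATIM with «`B'` finite cyclic ⟹ `𝒦_{v,n}[p^∞]` finite cyclic» as conclusion (any `p`, `v ∤ p`);
* §3 `finite_isAddCyclic_localTowerKerPrimary_of_additive_of_odd_ord`, `pTorsion_le_two_of_additive_of_odd_ord` — `B'` has order `≤ 4`
  (tree) and at most `2` elements killed by `2` (part 1: `Δ_min ∉ (K_v^nr)²` ⟹ `#E(K_v^nr)[2] ≤ 2`), so it is cyclic;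
* §4 the decidable CERTIFICATE over `ℚ`: `ℓ ∣ c₄`, `ℓ^k ∥ Δ_min`, `2 ∤ k` ⟹ additive at `ℓ` with `ord_ℓ(Δ_min)` odd, and the one-bit
  bound from it (`pTorsion_le_two_of_cert_odd_ord`); the seven-disjunct dispatcher and the doors follow in `…MultUpperHalfTowerFiltAddv3`.
HONEST FRAMING (cell `bsd-2adic`, run/shared/lean/pub/bsd-2adic/, seat `bsd-2adic-mult-2` GEN 10, HUMAN RULINGS D-0036 / D-0054 /
D-0074 row (A)): research route; THEOREMS ONLY — no definition, no new named fact; nothing is booked; BSD is not proved by any of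
this. PARTITION: X5@2 mult (K4ᵐ, RESIDUAL-MAP B1·O1; the 434 `E[2]`-irreducible classes without class file after GEN 9) × p = 2 —
types-the-object-of (the per-prime local constant of the TOWER-gap certificate of item 19922); closes none.
WHAT IS DISPLAYED, NOT PROVED: nothing (the sibling disjuncts keep their binders `h33g`/`hM`/`hA`, all tree theorems `…_holds`).
∀-LEVEL CONTENT: none.
References: R. Greenberg, LNM 1716 (1999), §3 Lemma 3.3 (pp. 86–88); J. H. Silverman, *AEC* (2009) III.2.3(d), VII.1 Prop. 1.3,
VII.5.1, VII.6.1; *ATAEC* (1994) IV.9 Table 4.1.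
-/

set_option autoImplicit false
-- the Theorems namespace of this sub repeats the summit name by design (D-0017 nested layout: Summit.<S>.<Sub>)
set_option linter.dupNamespace false

noncomputable section

open scoped Classical NNReal
open NumberField IsDedekindDomain Field Polynomial IsLocalRing

universe u

/-! ## §2 `𝒦_{v,n}[p^∞]` is cyclic when the inertia-fixed `p`-power torsion is (any `v ∤ p`, any `ℤ_p`-extension, every layer) -/

namespace Summit.BirchSwinnertonDyer.BirchSwinnertonDyer.Theorems.MultTowerOddOrd

open Literature.NumberTheory.EllipticCurves Literature.NumberTheory.EllipticCurves.Greenberg1999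
  Literature.NumberTheory.GaloisRepresentations
  Literature.NumberTheory.EllipticCurves.FormalGroupChart Literature.NumberTheory.EllipticCurves.ResKernel
  Literature.NumberTheory.DiophantineGeometry Literature.NumberTheory.DiophantineGeometry.KodairaSymbol
  _root_.Field _root_.IsDedekindDomain.HeightOneSpectrum _root_.WeierstrassCurve

section Transfer

variable {K : Type u} [Field K] [NumberField K] (W : WeierstrassCurve K) {v : HeightOneSpectrum (𝓞 K)}
  {p : ℕ} [Fact p.Prime] (κ : ZpExtension K p)

/-- **Every `p`-power torsion class of `M/f(M)` is the class of an element of `B = M[p^∞]`**, when `M/B` is `p`-divisible —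
verbatim copy of the tree's private `exists_primary_mk_eq_of_divisible'` (`ControlLocalKernelsLayerAdditiveProofs`). [folklore] -/
private theorem exists_primary_mk_eq_of_divisible_oddOrd {M : Type*} [AddCommGroup M] (p : ℕ) (f : M →+ M)
    (hdiv : ∀ y : M, ∃ y' : M, y - p • y' ∈ AddCommGroup.primaryComponent M p)
    (q : M ⧸ f.range) (hq : q ∈ AddCommGroup.primaryComponent (M ⧸ f.range) p) :
    ∃ b : M, b ∈ AddCommGroup.primaryComponent M p ∧ (b : M ⧸ f.range) = q := by
  induction q using QuotientAddGroup.induction_on with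
  | H x =>
    rw [PrimaryCoinvariants.mem_primaryComponent_iff_exists_nsmul] at hq
    obtain ⟨k, hk⟩ := hq
    rw [← QuotientAddGroup.mk_nsmul, QuotientAddGroup.eq_zero_iff] at hk
    obtain ⟨y, hy⟩ := hk
    obtain ⟨y', hy'⟩ := PrimaryCoinvariants.exists_sub_pow_smul_mem p hdiv k y
    have hmem : x - f y' ∈ AddCommGroup.primaryComponent M p := by
      refine PrimaryCoinvariants.mem_primaryComponent_of_nsmul_mem p (k := k) ?_
      have e : p ^ k • (x - f y') = f (y - p ^ k • y') := by
        rw [smul_sub, map_sub, map_nsmul, hy]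
      rw [e]
      exact PrimaryCoinvariants.map_mem_primaryComponent p f hy'
    refine ⟨x - f y', hmem, ?_⟩
    rw [QuotientAddGroup.eq_iff_sub_mem]
    exact ⟨-y', by rw [map_neg]; abel⟩


set_option maxHeartbeats 1600000 in
/-- **`𝒦_{v,n}[p^∞]` is finite CYCLIC when `E(K̄_v)^{I}[p^∞]` is** (`v ∤ p`, ANY `ℤ_p`-extension, every `n`). The tree's
`finite_and_natCard_localTowerKerPrimary_le_of_inertiaPrimary` VERBATIM (`𝒦_{v,n}[p^∞] ↪ M'/(g − 1)M'`, `M' = E(K̄_v)^{I}`, inside the image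
of `B' = M'[p^∞]`, `M'/B'` being `p`-divisible: Greenberg, LNM 1716, pp. 87–88), with the final count replaced by «a group embedded in a
homomorphic image of a finite cyclic group is finite cyclic, of order dividing it» (`MultTowerOddOrd.finite_isAddCyclic_of_embedding`).
[cite: GreenbergLNM1716, §3 Lemma 3.3 (proof, PDF pp. 87–88)] -/
theorem finite_isAddCyclic_localTowerKerPrimary_of_inertiaPrimary_cyclic [W.IsElliptic]
    (hpv : (p : 𝓞 K) ∉ v.asIdeal) (n : ℕ)
    {𝔐 : Ideal (localAbsIntegers v)} (h𝔐 : 𝔐 ∈ v.localPrimesAbove)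
    [(𝔐.inertia (absoluteGaloisGroup (v.adicCompletion K))).Normal]
    {g : absoluteGaloisGroup (v.adicCompletion K)}
    (hg : g ∈ localSubgroup (κ.layerSubgroup n) (v.adicCompletion K))
    (hgen : ∀ U : Subgroup (absoluteGaloisGroup (v.adicCompletion K)),
      IsOpen (U : Set (absoluteGaloisGroup (v.adicCompletion K))) →
        𝔐.inertia (absoluteGaloisGroup (v.adicCompletion K)) ≤ U → g ∈ U →
        localSubgroup (κ.layerSubgroup n) (v.adicCompletion K) ≤ U)
    (hfinB : Finite (AddCommGroup.primaryComponent
      (FixedPoints.addSubgroup (𝔐.inertia (absoluteGaloisGroup (v.adicCompletion K)))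
        (localPoints W (v.adicCompletion K))) p))
    (hcycB : IsAddCyclic (AddCommGroup.primaryComponent
      (FixedPoints.addSubgroup (𝔐.inertia (absoluteGaloisGroup (v.adicCompletion K)))
        (localPoints W (v.adicCompletion K))) p)) :
    Finite (W.localTowerKerPrimary κ (v.adicCompletion K) n) ∧
      IsAddCyclic (W.localTowerKerPrimary κ (v.adicCompletion K) n) ∧
      Nat.card (W.localTowerKerPrimary κ (v.adicCompletion K) n) ∣
        Nat.card (AddCommGroup.primaryComponent
          (FixedPoints.addSubgroup (𝔐.inertia (absoluteGaloisGroup (v.adicCompletion K)))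
            (localPoints W (v.adicCompletion K))) p) := by
  classical
  revert hfinB hcycB
  -- notation
  let G : Type u := Field.absoluteGaloisGroup (v.adicCompletion K)
  let Pt : Type u := localPoints W (v.adicCompletion K)
  set I : Subgroup G := 𝔐.inertia G with hIdef
  -- the spectral valuation, `p ∈ 𝓞_vˣ`
  obtain ⟨w, hw⟩ := v.exists_spectralValuation
  have hp : IsUnit ((p : ℕ) : (v.adicCompletionIntegers K)) := by
    have h := isUnit_algebraMap_adicCompletionIntegers K v hpv
    rwa [map_natCast] at h
  -- the equivariant transport `E(K̄_v) ≃ V(K̄_v)` to the minimal model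
  obtain ⟨C, hC⟩ := W.exists_variableChange_eq_localMinimalIntegralModel v
  haveI := WeierstrassCurve.isIntegral_spectralValuation_baseChange hw (W.localMinimalIntegralModel v)
  have hC' := congrArg (fun X : WeierstrassCurve (v.adicCompletion K) ↦ X.baseChange (AlgebraicClosure (v.adicCompletion K))) hC
  let Φ : Pt ≃+ (((W.localMinimalIntegralModel v).map (algebraMap (v.adicCompletionIntegers K) (v.adicCompletion K))).baseChange (AlgebraicClosure (v.adicCompletion K))).toAffine.Point :=
    ((WeierstrassCurve.Affine.Point.congrEquiv
        (WeierstrassCurve.baseChange_baseChange_adicCompletion W v).symm).trans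
      (WeierstrassCurve.VariableChange.pointEquivBaseChange (W.baseChange (v.adicCompletion K)) C
        (AlgebraicClosure (v.adicCompletion K)))).trans
      (WeierstrassCurve.Affine.Point.congrEquiv hC')
  have hΦ : ∀ (σ : G) (Q : Pt), Φ (σ • Q) = Affine.Point.map ((absoluteGaloisGroup.toAlgEquiv (v.adicCompletion K) σ : AlgebraicClosure (v.adicCompletion K) ≃ₐ[v.adicCompletion K] AlgebraicClosure (v.adicCompletion K)) : AlgebraicClosure (v.adicCompletion K) →ₐ[v.adicCompletion K] AlgebraicClosure (v.adicCompletion K)) (Φ Q) := by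
    intro σ Q
    change WeierstrassCurve.Affine.Point.congrEquiv hC'
        (WeierstrassCurve.VariableChange.pointEquivBaseChange (W.baseChange (v.adicCompletion K)) C (AlgebraicClosure (v.adicCompletion K))
        (WeierstrassCurve.Affine.Point.congrEquiv (WeierstrassCurve.baseChange_baseChange_adicCompletion W v).symm (σ • Q))) =
      WeierstrassCurve.Affine.Point.map _ (WeierstrassCurve.Affine.Point.congrEquiv hC'
        (WeierstrassCurve.VariableChange.pointEquivBaseChange (W.baseChange (v.adicCompletion K)) C (AlgebraicClosure (v.adicCompletion K))
          (WeierstrassCurve.Affine.Point.congrEquiv (WeierstrassCurve.baseChange_baseChange_adicCompletion W v).symm Q)))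
    rw [WeierstrassCurve.congrEquiv_smul, WeierstrassCurve.VariableChange.pointEquivBaseChange_map_algEquiv]
    exact WeierstrassCurve.Affine.Point.congrEquiv_baseChange_map hC _ _
  -- `M' = E(K̄_v)^{I}`, `f = g - 1`, `B' = M'[p^∞]`
  set Mi : AddSubgroup Pt := FixedPoints.addSubgroup I Pt with hMi
  set f : Mi →+ Mi := subOne I Pt g with hf
  set B : AddSubgroup Mi := AddCommGroup.primaryComponent Mi p with hB
  intro hfinB hcycB
  have hMiI : ∀ (m : Mi) (τ : G), τ ∈ I → Affine.Point.map ((absoluteGaloisGroup.toAlgEquiv (v.adicCompletion K) τ : AlgebraicClosure (v.adicCompletion K) ≃ₐ[v.adicCompletion K] AlgebraicClosure (v.adicCompletion K)) : AlgebraicClosure (v.adicCompletion K) →ₐ[v.adicCompletion K] AlgebraicClosure (v.adicCompletion K)) (Φ m) = Φ m := by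
    intro m τ hτ
    rw [← hΦ]
    exact congrArg Φ (m.2 ⟨τ, hτ⟩)
  -- (a) `M'/B'` is `p`-divisible (verbatim from the tree's Lemma 3.3 at `n = 0`; inertia only)
  have hdiv : ∀ y : Mi, ∃ y' : Mi, y - p • y' ∈ B := by
    intro y
    obtain ⟨m, hm, hmK⟩ :=
      W.exists_nsmul_mem_kernel_of_forall_inertia hw h𝔐 (P := Φ y) (fun τ hτ ↦ hMiI y τ hτ)
    obtain ⟨a, b, hb, hmab⟩ :=
      Nat.exists_eq_pow_mul_and_not_dvd hm.ne' p (Fact.out : p.Prime).ne_one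
    have hmI : ∀ τ ∈ 𝔐.inertia G, Affine.Point.map ((absoluteGaloisGroup.toAlgEquiv (v.adicCompletion K) τ : AlgebraicClosure (v.adicCompletion K) ≃ₐ[v.adicCompletion K] AlgebraicClosure (v.adicCompletion K)) : AlgebraicClosure (v.adicCompletion K) →ₐ[v.adicCompletion K] AlgebraicClosure (v.adicCompletion K)) (m • Φ y) = m • Φ y :=
      fun τ hτ ↦ by rw [map_nsmul, hMiI y τ hτ]
    obtain ⟨u, -, hufix, hu⟩ := W.exists_pow_nsmul_eq_of_mem_kernel hw h𝔐 hp (a + 1) hmK hmI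
    have hu' : Φ.symm u ∈ Mi := by
      rintro ⟨h, hh⟩
      show h • Φ.symm u = Φ.symm u
      apply Φ.injective
      rw [hΦ, AddEquiv.apply_symm_apply]
      refine hufix h ?_
      rw [map_nsmul, ← hΦ]
      exact congrArg (fun z ↦ m • Φ z) (y.2 ⟨h, hh⟩)
    set u' : Mi := ⟨Φ.symm u, hu'⟩ with hu'def
    have hT₀ : b • y - p • u' ∈ B := by
      rw [hB, PrimaryCoinvariants.mem_primaryComponent_iff_exists_nsmul]
      refine ⟨a, ?_⟩
      apply Subtype.ext
      apply Φ.injective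
      simp only [smul_sub, AddSubgroupClass.coe_nsmul, AddSubgroupClass.coe_sub, map_sub, map_nsmul,
        ZeroMemClass.coe_zero, map_zero, hu'def, AddEquiv.apply_symm_apply]
      rw [← mul_smul, ← mul_smul, ← pow_succ, hu, ← hmab, sub_self]
    have hcop : IsCoprime (b : ℤ) (p : ℤ) :=
      Nat.isCoprime_iff_coprime.mpr ((Nat.Prime.coprime_iff_not_dvd Fact.out).mpr hb).symm
    obtain ⟨α, β, hαβ⟩ := hcop
    refine ⟨α • u' + β • y, ?_⟩
    have e : y - p • (α • u' + β • y) = α • (b • y - p • u') := by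
      have h2 : (1 - (α * b + β * p)) • y = 0 := by rw [hαβ, sub_self, zero_smul]
      have h3 : y - p • (α • u' + β • y) - α • (b • y - p • u') = (1 - (α * b + β * p)) • y := by
        module
      rw [← sub_eq_zero, h3, h2]
    rw [e]
    exact B.zsmul_mem hT₀ α
  -- the embedding `ψ : 𝒦_{v,n} ↪ M'/(g-1)M'` and its restriction `ι` to `𝒦_{v,n}[p^∞]`
  obtain ⟨ψ, hψ⟩ :=
    exists_addMonoidHom_localTowerKer_injective_inertia W κ n hpv h𝔐 hg hgen
  have hle : W.localTowerKerPrimary κ (v.adicCompletion K) n ≤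
      W.localTowerKer κ (v.adicCompletion K) n := fun x hx ↦ hx.1
  let ι : W.localTowerKerPrimary κ (v.adicCompletion K) n →+ Mi ⧸ f.range :=
    ψ.comp (AddSubgroup.inclusion hle)
  have hι : Function.Injective ι := hψ.comp (AddSubgroup.inclusion_injective hle)
  -- `ρ : B' → M'/(g-1)M'`; the image of `ι` lies in the image of `ρ`
  let ρ : B →+ Mi ⧸ f.range := (QuotientAddGroup.mk' f.range).comp B.subtype
  have hρ : ∀ x : W.localTowerKerPrimary κ (v.adicCompletion K) n, ι x ∈ ρ.range := by
    intro x
    obtain ⟨k, hk⟩ := x.2.2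
    have hq : ι x ∈ AddCommGroup.primaryComponent (Mi ⧸ f.range) p := by
      rw [PrimaryCoinvariants.mem_primaryComponent_iff_exists_nsmul]
      refine ⟨k, ?_⟩
      rw [← map_nsmul]
      have : p ^ k • x = 0 := Subtype.ext (by rw [AddSubgroupClass.coe_nsmul, hk]; rfl)
      rw [this, map_zero]
    obtain ⟨b, hb, hbq⟩ := exists_primary_mk_eq_of_divisible_oddOrd p f hdiv _ hq
    exact ⟨⟨b, hb⟩, hbq⟩
  -- inside the cyclic image of `B'`
  haveI : Finite B := hfinB
  haveI : IsAddCyclic B := hcycB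
  exact finite_isAddCyclic_of_embedding ι hι ρ hρ

end Transfer

/-! ## §3 `𝒦_{v,n}[2^∞]` is cyclic at an additive `v ∤ 2` with `ord_v(Δ_min)` odd: ONE bit -/

section OddOrd

variable {K : Type u} [Field K] [NumberField K] (W : WeierstrassCurve K) {v : HeightOneSpectrum (𝓞 K)}
  (κ : ZpExtension K 2)

set_option maxHeartbeats 1600000 in
/-- **`𝒦_{v,n}[2^∞]` is finite CYCLIC of order `≤ 4` at an additive `v ∤ 2` whose minimal discriminant has ODD valuation**, at EVERY
layer `n` of ANY `ℤ₂`-extension (Kodaira types `I_n*` with `n` odd, `III`, `III*`; *ATAEC* Table 4.1: `Φ(k̄_v) = ℤ/4, ℤ/2, ℤ/2`).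
Proof: `B' = E(K̄_v)^{I}[2^∞]` is finite of order `≤ 4` (tree `finite_and_natCard_inertiaFixed_primary_le_four_of_hasAdditiveReduction`,
Greenberg p. 88) with at most `2` elements killed by `2` (part 1, `finite_and_natCard_inertiaFixed_twoTorsion_le_two_of_odd_addVal`:
`Δ_min ∉ (K_v^nr)²`), hence cyclic (`isAddCyclic_of_natCard_le_four`); and `𝒦_{v,n}[2^∞]` embeds in a quotient of `B'` (§2). The setting
is the tree's `finite_and_natCard_localTowerKerPrimary_le_four_of_additive` VERBATIM.
[cite: GreenbergLNM1716, §3 Lemma 3.3 (proof, PDF pp. 87–88)] [cite: SilvermanAEC2009, Thm. VII.6.1] [cite: SilvermanATAEC1994, IV.9 Table 4.1] -/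
theorem finite_isAddCyclic_localTowerKerPrimary_of_additive_of_odd_ord [W.IsElliptic]
    (hpv : ((2 : ℕ) : 𝓞 K) ∉ v.asIdeal) (hadd : W.HasAdditiveReductionAt v)
    (hodd : Odd (W.ordMinimalDiscriminant v)) (n : ℕ) :
    Finite (W.localTowerKerPrimary κ (v.adicCompletion K) n) ∧
      IsAddCyclic (W.localTowerKerPrimary κ (v.adicCompletion K) n) ∧
      Nat.card (W.localTowerKerPrimary κ (v.adicCompletion K) n) ≤ 4 := by
  classical
  haveI : Fact (Nat.Prime 2) := ⟨Nat.prime_two⟩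
  let G : Type u := Field.absoluteGaloisGroup (v.adicCompletion K)
  let Pt : Type u := localPoints W (v.adicCompletion K)
  -- the prime `𝔐`, a Frobenius, the generator `g = F^M`
  obtain ⟨𝔐, h𝔐⟩ := v.localPrimesAbove_nonempty
  haveI hInormal : (𝔐.inertia G).Normal := inertia_normal_of_mem_localPrimesAbove v h𝔐
  obtain ⟨F, hF⟩ := exists_isArithFrobAt_localAbsIntegers (v := v) h𝔐
  obtain ⟨M, -, hgHn, hgen⟩ := exists_frobenius_pow_generate_localSubgroup κ hpv h𝔐 hF n
  obtain ⟨w, hw⟩ := v.exists_spectralValuation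
  -- the minimal model and the equivariant transport
  set X := W.localMinimalModel v with hXdef
  haveI : X.IsElliptic := W.isElliptic_localMinimalModel v
  haveI : X.HasAdditiveReduction (v.adicCompletionIntegers K) := hadd
  obtain ⟨hfinS, hS⟩ :=
    X.finite_and_natCard_inertiaFixed_primary_le_four_of_hasAdditiveReduction w hw h𝔐 Nat.prime_two hpv
  have hodd' : Odd (IsDiscreteValuationRing.addVal (v.adicCompletionIntegers K)
      (X.integralModel (v.adicCompletionIntegers K)).Δ).toNat := hodd
  obtain ⟨hfinS₂, hS₂⟩ :=
    X.finite_and_natCard_inertiaFixed_twoTorsion_le_two_of_odd_addVal w hw h𝔐 hodd'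
  obtain ⟨C, hC⟩ := W.exists_variableChange_smul_eq_localMinimalModel v
  obtain ⟨Φ, hΦ⟩ := W.exists_addEquiv_localPoints_of_smul_eq v hC
  -- `B' = E(K̄_v)^{I}[2^∞]` injects into the counted set, its `2`-torsion into the `2`-torsion one
  set Mi : AddSubgroup Pt := FixedPoints.addSubgroup (𝔐.inertia G) Pt with hMi
  set B : AddSubgroup Mi := AddCommGroup.primaryComponent Mi 2 with hB
  have hfix : ∀ (b : Mi) (σ : G), σ ∈ 𝔐.inertia (absoluteGaloisGroup (v.adicCompletion K)) →
      Affine.Point.map ((absoluteGaloisGroup.toAlgEquiv _ σ :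
          AlgebraicClosure (v.adicCompletion K) ≃ₐ[v.adicCompletion K]
            AlgebraicClosure (v.adicCompletion K)) :
          AlgebraicClosure (v.adicCompletion K) →ₐ[v.adicCompletion K]
            AlgebraicClosure (v.adicCompletion K)) (Φ (b : Pt)) = Φ (b : Pt) := fun b σ hσ ↦ by
    rw [← hΦ]
    exact congrArg Φ (b.2 ⟨σ, hσ⟩)
  let j : B → {P : (X.baseChange (AlgebraicClosure (v.adicCompletion K))).toAffine.Point //
        (∀ σ ∈ 𝔐.inertia (absoluteGaloisGroup (v.adicCompletion K)),
          Affine.Point.map ((absoluteGaloisGroup.toAlgEquiv _ σ :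
              AlgebraicClosure (v.adicCompletion K) ≃ₐ[v.adicCompletion K]
                AlgebraicClosure (v.adicCompletion K)) :
              AlgebraicClosure (v.adicCompletion K) →ₐ[v.adicCompletion K]
                AlgebraicClosure (v.adicCompletion K)) P = P) ∧
        ∃ k : ℕ, 2 ^ k • P = 0} := fun b ↦
    ⟨Φ ((b : Mi) : Pt), hfix (b : Mi), by
        obtain ⟨k, hk⟩ := (AddCommGroup.mem_primaryComponent).mp b.2
        refine ⟨k, ?_⟩
        rw [← map_nsmul, ← AddSubgroupClass.coe_nsmul, hk]
        exact map_zero Φ⟩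
  have hj : Function.Injective j := by
    intro a b hab
    have h := congrArg Subtype.val hab
    exact Subtype.ext (Subtype.ext (Φ.injective h))
  haveI hfinB : Finite B := Finite.of_injective j hj
  have hB4 : Nat.card B ≤ 4 := (Nat.card_le_card_of_injective j hj).trans hS
  let j₂ : {b : B // 2 • b = 0} → {P : (X.baseChange (AlgebraicClosure (v.adicCompletion K))).toAffine.Point //
        (∀ σ ∈ 𝔐.inertia (absoluteGaloisGroup (v.adicCompletion K)),
          Affine.Point.map ((absoluteGaloisGroup.toAlgEquiv _ σ :
              AlgebraicClosure (v.adicCompletion K) ≃ₐ[v.adicCompletion K]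
                AlgebraicClosure (v.adicCompletion K)) :
              AlgebraicClosure (v.adicCompletion K) →ₐ[v.adicCompletion K]
                AlgebraicClosure (v.adicCompletion K)) P = P) ∧
        2 • P = 0} := fun b ↦
    ⟨Φ (((b : B) : Mi) : Pt), hfix ((b : B) : Mi), by
        have hb : 2 • ((((b : B) : Mi) : Pt)) = 0 := by
          rw [← AddSubgroupClass.coe_nsmul, ← AddSubgroupClass.coe_nsmul, b.2]; rfl
        rw [← map_nsmul, hb, map_zero]⟩
  have hj₂ : Function.Injective j₂ := by
    intro a b hab
    have h := congrArg Subtype.val hab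
    exact Subtype.ext (Subtype.ext (Subtype.ext (Φ.injective h)))
  have hB2 : Nat.card {b : B // 2 • b = 0} ≤ 2 := by
    haveI := hfinS₂
    exact (Nat.card_le_card_of_injective j₂ hj₂).trans hS₂
  haveI hcycB : IsAddCyclic B := isAddCyclic_of_natCard_le_four hB4 hB2
  obtain ⟨hfin, hcyc, hdvd⟩ := finite_isAddCyclic_localTowerKerPrimary_of_inertiaPrimary_cyclic W κ hpv n h𝔐
    hgHn hgen hfinB hcycB
  exact ⟨hfin, hcyc, (Nat.le_of_dvd Nat.card_pos hdvd).trans hB4⟩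

/-- **Corollary (counted currency): `#𝒦_{v,n}[2^∞][2] ≤ 2`** — ONE bit — at an additive `v ∤ 2` with `ord_v(Δ_min)` odd, at every
layer of every `ℤ₂`-extension (a finite cyclic group has at most `2` elements killed by `2`).
[cite: GreenbergLNM1716, §3 Lemma 3.3 (proof, PDF p. 88)] [cite: SilvermanATAEC1994, IV.9 Table 4.1] -/
theorem pTorsion_le_two_of_additive_of_odd_ord [W.IsElliptic]
    (hpv : ((2 : ℕ) : 𝓞 K) ∉ v.asIdeal) (hadd : W.HasAdditiveReductionAt v)
    (hodd : Odd (W.ordMinimalDiscriminant v)) (n : ℕ) :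
    Finite {x : W.localTowerKerPrimary κ (v.adicCompletion K) n // 2 • x = 0} ∧
      Nat.card {x : W.localTowerKerPrimary κ (v.adicCompletion K) n // 2 • x = 0} ≤ 2 := by
  obtain ⟨hfin, hcyc, -⟩ := finite_isAddCyclic_localTowerKerPrimary_of_additive_of_odd_ord W κ hpv hadd hodd n
  haveI := hfin
  haveI := hcyc
  exact ⟨Finite.of_injective _ Subtype.val_injective, natCard_two_nsmul_eq_zero_le_two⟩

end OddOrd

end Summit.BirchSwinnertonDyer.BirchSwinnertonDyer.Theorems.MultTowerOddOrd

/-! ## §4 The certificate over `ℚ`: additive with `ord_ℓ(Δ_min)` odd from `(ℓ ∣ c₄, ℓ^k ∥ Δ_min, 2 ∤ k)` -/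

namespace Summit.BirchSwinnertonDyer.BirchSwinnertonDyer.Theorems.MultTowerAddv

open Literature.NumberTheory.EllipticCurves Literature.NumberTheory.EllipticCurves.Greenberg1999
  Literature.NumberTheory.GaloisRepresentations
  Literature.NumberTheory.DiophantineGeometry Literature.NumberTheory.DiophantineGeometry.KodairaSymbol
  Field IsDedekindDomain.HeightOneSpectrum WeierstrassCurve Rat.HeightOneSpectrum
  Summit.BirchSwinnertonDyer.BirchSwinnertonDyer.Theorems.MultTowerOddOrd

section OddOrdCert

variable (W : WeierstrassCurve ℚ) [W.IsElliptic] [W.IsGloballyMinimal]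

/-- **Additive reduction with `ord_ℓ(Δ_min)` ODD at an odd prime `ℓ`**, for a globally minimal `W/ℚ` at the place `v ↔ ℓ`, from decidable
data: `ℓ ∣ c₄`, `ℓ^k ∥ Δ_min`, `2 ∤ k` (additive by *AEC* VII.5.1(c); `ord_v(Δ_min) = k` by the tree's `ordMinimalDiscriminant_eq_padicValInt`).
[cite: SilvermanAEC2009, VII.1 Prop. 1.3 and VII.5 Prop. 5.1(c)] -/
theorem hasAdditiveReductionAt_and_odd_ord_of_cert (v : HeightOneSpectrum (𝓞 ℚ)) {ℓ : ℕ}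
    [Fact ℓ.Prime] (hv : (primesEquiv v : ℕ) = ℓ)
    (hc₄ : (ℓ : ℤ) ∣ (integralModelInt W).c₄) {k : ℕ} (hk : (ℓ : ℤ) ^ k ∣ W.minimalDiscriminantInt)
    (hk' : ¬ (ℓ : ℤ) ^ (k + 1) ∣ W.minimalDiscriminantInt) (hodd : ¬ 2 ∣ k) :
    W.HasAdditiveReductionAt v ∧ Odd (W.ordMinimalDiscriminant v) := by
  have hk1 : 1 ≤ k := by
    rcases Nat.eq_zero_or_pos k with rfl | h
    · exact absurd (dvd_zero 2) hodd
    · exact h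
  have hℓΔ : (ℓ : ℤ) ∣ W.minimalDiscriminantInt := (dvd_pow_self (ℓ : ℤ) (by omega)).trans hk
  have hadd : W.HasAdditiveReductionAt v :=
    W.hasAdditiveReductionAt_of_dvd_of_dvd v (by rw [hv]; exact hℓΔ) (by rw [hv]; exact hc₄)
  refine ⟨hadd, ?_⟩
  rw [LocalTorsionMult.ordMinimalDiscriminant_eq_padicValInt W v hv,
    KatoHalfPinch.padicValInt_eq_of_dvd_of_not_dvd hk hk']
  exact Nat.odd_iff.mpr (Nat.two_dvd_ne_zero.mp hodd)

/-- **ONE bit at an odd additive prime with `ord_ℓ(Δ_min)` odd, from the certificate** (`ℓ ∣ c₄`, `ℓ^k ∥ Δ_min`, `2 ∤ k`): at the place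
`v ↔ ℓ`, `#𝒦_{v,n}[2^∞][2] ≤ 2` at every layer of every `ℤ₂`-extension of `ℚ`.
[cite: GreenbergLNM1716, §3 Lemma 3.3 (proof, PDF p. 88)] [cite: SilvermanATAEC1994, IV.9 Table 4.1] -/
theorem pTorsion_le_two_of_cert_odd_ord (κ : ZpExtension ℚ 2) (v : HeightOneSpectrum (𝓞 ℚ)) {ℓ : ℕ}
    [Fact ℓ.Prime] (hv : (primesEquiv v : ℕ) = ℓ) (hℓ2 : ℓ ≠ 2)
    (hc₄ : (ℓ : ℤ) ∣ (integralModelInt W).c₄) {k : ℕ} (hk : (ℓ : ℤ) ^ k ∣ W.minimalDiscriminantInt)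
    (hk' : ¬ (ℓ : ℤ) ^ (k + 1) ∣ W.minimalDiscriminantInt) (hodd : ¬ 2 ∣ k) (n : ℕ) :
    Finite {x : W.localTowerKerPrimary κ (v.adicCompletion ℚ) n // 2 • x = 0} ∧
      Nat.card {x : W.localTowerKerPrimary κ (v.adicCompletion ℚ) n // 2 • x = 0} ≤ 2 := by
  have h2v : ((2 : ℕ) : 𝓞 ℚ) ∉ v.asIdeal := by
    rw [KatoHalfPinch.natCast_prime_mem_asIdeal_iff v Nat.prime_two]
    change natGenerator v ≠ 2
    rw [show natGenerator v = ℓ from hv]; exact hℓ2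
  obtain ⟨hadd, hodd'⟩ := hasAdditiveReductionAt_and_odd_ord_of_cert W v hv hc₄ hk hk' hodd
  exact pTorsion_le_two_of_additive_of_odd_ord W κ h2v hadd hodd' n

end OddOrdCert

end Summit.BirchSwinnertonDyer.BirchSwinnertonDyer.Theorems.MultTowerAddv

end
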